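import Summits.AtomisticToContinuum.HydrodynamicLimit.Theorems.AntiMazurCoboundariesCellForecastPressureDecayKinematicAssemblyNoCollision
import Summits.AtomisticToContinuum.HydrodynamicLimit.Theorems.LambertianContactSwapCollisionMomentBoundBridge
import Literature.Analysis.FluidPDE.HardSphereTorusMeasure
import Literature.Analysis.FluidPDE.HardSphereFreeStretch
import Literature.MathematicalPhysics.KineticTheory.HardSphereEuler
import HarnessLib

/-!
# Two-body kinematics of an isolated pair on `𝕋³` inside a chart (registered stub `stub_torusIsolatedPair`,
# refutation line `ignition-cascade-refutation`, crux `InfluenceLocality`, stmt-AtomisticToContinuum-13916)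

Torus port of the Euclidean `fresh_collision`, `not_mem_contactSet_after`, `not_participates_after`,
`isolated_pair` of `…CellForecastPressureDecayKinematicAssemblyIsolatedPair` (namespace `EnskogCompensator`).
On the flat torus the relative position of the pair `(i, j)` is the minimal image
`q = sep(xᵢ, xⱼ) = reprSym (xᵢ − xⱼ)` and free flight is `x ↦ x + proj (s v)`; as long as the pair stays in
ONE chart (`‖q‖ + (b − a)‖u‖ < 1/2`, `u = vᵢ − vⱼ`) the relative kinematics is Euclidean:
`sep(xᵢ + proj((s − a)vᵢ), xⱼ + proj((s − a)vⱼ)) = q + (s − a) u` (`Torus.sepVec_translate_of_norm_lt`).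

* `torus_sepVec_translate_smul` — the chart identity above (after its collision the pair stays in the
  chart because the elastic reflection preserves the relative speed, `norm_reflectVel_fst_sub_snd` of
  `…LambertianContactSwapCollisionMomentBoundBridge`);
* `torus_fresh_collision` — a contact at `t` of two spheres that flew freely on `(a, t)`: impact vector
  `n = q + (t − a)u` with `‖n‖ = ε`, `⟪n, u⟫ < 0`, time-`t` states = flown positions, reflected velocities;
* `torus_not_mem_contactSet_after`, `torus_not_participates_after` — no recollision while the pair is
  isolated (after the jump the pair is outgoing and `‖n + τ u'‖² = ε² + 2τ⟪n, u'⟫ + τ²‖u'‖² > ε²`);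
* `stub_torusIsolatedPair` — the registered statement.

References: Cercignani–Illner–Pulvirenti 1994 §4.2; Gallagher–Saint-Raymond–Texier 2013 §4.1 and Ch. 4
(introduction: on the torus the theory is identical with the minimal-image convention).
-/

namespace Summit.AtomisticToContinuum.HydrodynamicLimit.Theorems.InfluenceLocality.Negative

open Set Filter Topology
open scoped InnerProductSpace
open Literature.Analysis.FluidPDE Literature.MathematicalPhysics.KineticTheory
open Literature.Analysis.FunctionSpaces
open Summit.AtomisticToContinuum.HydrodynamicLimit.Theorems.EnskogCompensator
  (apply_eq_freeFlight_of_forall_not_participates)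
open Summit.AtomisticToContinuum.HydrodynamicLimit.Theorems.LambertianContactSwapCollisionMomentBound
  (norm_reflectVel_fst_sub_snd)

noncomputable section

/-! ## Trajectory level: chart kinematics of a pair on the flat torus -/

section Torus

variable {d : Type*} [Fintype d] {N : ℕ} {ε : ℝ} {γ : ℝ → Config N d (UnitAddTorus d)}

/-- In a chart the minimal-image separation of a freely flying pair is affine in time: if
`‖sep(x, y)‖ + s ‖v − w‖ < 1/2` and `0 ≤ s` then `sep(x + proj(s v), y + proj(s w)) = sep(x, y) + s (v − w)`. -/
theorem torus_sepVec_translate_smul {x y : UnitAddTorus d} {v w : EuclideanSpace ℝ d} {s : ℝ}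
    (hs : 0 ≤ s) (h : ‖(Torus.geometry d).sepVec x y‖ + s * ‖v - w‖ < 1 / 2) :
    (Torus.geometry d).sepVec ((Torus.geometry d).translate x (s • v)) ((Torus.geometry d).translate y (s • w)) =
      (Torus.geometry d).sepVec x y + s • (v - w) := by
  have h' : ‖(Torus.geometry d).sepVec x y‖ + ‖s • v - s • w‖ < 1 / 2 := by
    rwa [← smul_sub, norm_smul, Real.norm_of_nonneg hs]
  rw [Torus.sepVec_translate_of_norm_lt h', smul_sub]

/-- Contact is symmetric on the torus (the minimal-image distance is symmetric). -/
theorem torus_mem_contactSet_comm {z : Config N d (UnitAddTorus d)} {i j : Fin N} :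
    z ∈ contactSet (Torus.geometry d) N ε i j ↔ z ∈ contactSet (Torus.geometry d) N ε j i := by
  rw [mem_contactSet, mem_contactSet, Torus.norm_geometry_sepVec, Torus.norm_geometry_sepVec,
    Torus.euclidDist_comm]

/-- If `i` collides with `k` on the torus then `(i, k)` is a contact pair. -/
theorem torus_mem_contactSet_of_collide {z : Config N d (UnitAddTorus d)} {i k : Fin N}
    (h : Collide (Torus.geometry d) ε z i k) : z ∈ contactSet (Torus.geometry d) N ε i k := by
  rcases h with h | h
  · exact (mem_contactPairs.1 h).2
  · exact torus_mem_contactSet_comm.1 (mem_contactPairs.1 h).2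

/-- Positions of a sphere that does not participate on `(a, b)` are the freely flown ones up to and
including time `b` (positions are continuous), in any geometry with continuous translations over a
Hausdorff position space. -/
theorem fst_eq_translate_of_forall_not_participates_Ioo {X : Type*} [TopologicalSpace X] [T2Space X]
    {G : Geometry d X} {γ : ℝ → Config N d X} (h : IsHardSphereTrajectory G ε N γ)
    (hG : ∀ x : X, Continuous (G.translate x)) {a b : ℝ} (hab : a < b) {i : Fin N}
    (hi : ∀ s ∈ Ioo a b, ¬ Participates G ε (γ s) i) :
    (γ b i).1 = G.translate (γ a i).1 ((b - a) • (γ a i).2) := by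
  have h1 : Tendsto (fun s => (γ s i).1) (𝓝[<] b) (𝓝 (γ b i).1) :=
    ((h.pos_continuous i).tendsto b).mono_left nhdsWithin_le_nhds
  have hsm : Continuous fun s : ℝ => (s - a) • (γ a i).2 := by fun_prop
  have hc : Continuous fun s : ℝ => G.translate (γ a i).1 ((s - a) • (γ a i).2) := (hG _).comp hsm
  have h2 : Tendsto (fun s => (γ s i).1) (𝓝[<] b) (𝓝 (G.translate (γ a i).1 ((b - a) • (γ a i).2))) := by
    refine ((hc.tendsto b).mono_left nhdsWithin_le_nhds).congr' ?_
    filter_upwards [Ioo_mem_nhdsLT hab] with s hs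
    rw [apply_eq_freeFlight_of_forall_not_participates h hG hs.1.le
      (fun τ hτ => hi τ ⟨hτ.1, hτ.2.trans_lt hs.2⟩)]
  exact tendsto_nhds_unique h1 h2

/-- **A fresh pair collides by the two-body kinematics (torus, in a chart).** On a hard-sphere trajectory of
`𝕋ᵈ`, if the spheres `i ≠ j` are in contact at time `t > a`, neither took part in a collision at the times of
`(a, t)`, and the pair stays in one chart (`‖q‖ + (t − a)‖u‖ < 1/2`, `q = sep(xᵢ(a), xⱼ(a))`,
`u = vᵢ(a) − vⱼ(a)`), then with the impact vector `n = q + (t − a) u`: `‖n‖ = ε`, `⟪n, u⟫ < 0`, and the states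
at time `t` are the freely flown positions with the reflected velocities `reflectVel n (vᵢ(a), vⱼ(a))`. -/
theorem torus_fresh_collision (h : IsHardSphereTrajectory (Torus.geometry d) ε N γ) {a t : ℝ} (hat : a < t)
    {i j : Fin N} (hij : i ≠ j) (hc : γ t ∈ contactSet (Torus.geometry d) N ε i j)
    (hi : ∀ s ∈ Ioo a t, ¬ Participates (Torus.geometry d) ε (γ s) i)
    (hj : ∀ s ∈ Ioo a t, ¬ Participates (Torus.geometry d) ε (γ s) j)
    (hchart : ‖(Torus.geometry d).sepVec (γ a i).1 (γ a j).1‖ + (t - a) * ‖(γ a i).2 - (γ a j).2‖ < 1 / 2) :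
    ‖(Torus.geometry d).sepVec (γ a i).1 (γ a j).1 + (t - a) • ((γ a i).2 - (γ a j).2)‖ = ε ∧
    ⟪(Torus.geometry d).sepVec (γ a i).1 (γ a j).1 + (t - a) • ((γ a i).2 - (γ a j).2),
      (γ a i).2 - (γ a j).2⟫_ℝ < 0 ∧
    γ t i = ((γ a i).1 + Torus.proj ((t - a) • (γ a i).2),
      (reflectVel ((Torus.geometry d).sepVec (γ a i).1 (γ a j).1 + (t - a) • ((γ a i).2 - (γ a j).2))
        ((γ a i).2, (γ a j).2)).1) ∧
    γ t j = ((γ a j).1 + Torus.proj ((t - a) • (γ a j).2),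
      (reflectVel ((Torus.geometry d).sepVec (γ a i).1 (γ a j).1 + (t - a) • ((γ a i).2 - (γ a j).2))
        ((γ a i).2, (γ a j).2)).2) := by
  have hGc : ∀ x, Continuous ((Torus.geometry d).translate x) := Torus.continuous_geometry_translate
  -- a point `y ∈ (a, t)` with `(y, t)` collision-free
  obtain ⟨s₀, hs₀t, hfree⟩ := h.exists_Ioo_left_free t
  set y : ℝ := max ((a + t) / 2) ((s₀ + t) / 2) with hy
  have hyt : y < t := max_lt (by linarith) (by linarith)
  have hay : a < y := lt_of_lt_of_le (by linarith) (le_max_left _ _)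
  have hsy : s₀ < y := lt_of_lt_of_le (by linarith) (le_max_right _ _)
  have hfree' : ∀ s ∈ Ioo y t, s ∉ collisionTimes (Torus.geometry d) ε γ := fun s hs =>
    hfree s ⟨hsy.trans hs.1, hs.2⟩
  -- both spheres fly freely on `[a, y]`
  have hiy : γ y i = ((Torus.geometry d).translate (γ a i).1 ((y - a) • (γ a i).2), (γ a i).2) :=
    apply_eq_freeFlight_of_forall_not_participates h hGc hay.le fun s hs => hi s ⟨hs.1, hs.2.trans_lt hyt⟩
  have hjy : γ y j = ((Torus.geometry d).translate (γ a j).1 ((y - a) • (γ a j).2), (γ a j).2) :=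
    apply_eq_freeFlight_of_forall_not_participates h hGc hay.le fun s hs => hj s ⟨hs.1, hs.2.trans_lt hyt⟩
  -- the left limit at `t` is the free flight from `γ y`
  set zl : Config N d (UnitAddTorus d) := freeFlight (Torus.geometry d) (t - y) (γ y) with hzl
  have hlim : Tendsto γ (𝓝[<] t) (𝓝 zl) := h.tendsto_nhdsLT hGc hyt hfree'
  have hya : (y - a) + (t - y) = t - a := by ring
  have hzli : zl i = ((γ a i).1 + Torus.proj ((t - a) • (γ a i).2), (γ a i).2) := by
    rw [hzl, freeFlight_apply, hiy]
    dsimp only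
    rw [Geometry.translate_add, ← add_smul, hya]
    rfl
  have hzlj : zl j = ((γ a j).1 + Torus.proj ((t - a) • (γ a j).2), (γ a j).2) := by
    rw [hzl, freeFlight_apply, hjy]
    dsimp only
    rw [Geometry.translate_add, ← add_smul, hya]
    rfl
  -- the binary clause at `t`
  obtain ⟨-, zl', hzl', hin, heq⟩ := h.binary t i j hij hc
  have hzz : zl' = zl := tendsto_nhds_unique hzl' hlim
  subst hzz
  have hsep : (Torus.geometry d).sepVec (zl i).1 (zl j).1 =
      (Torus.geometry d).sepVec (γ a i).1 (γ a j).1 + (t - a) • ((γ a i).2 - (γ a j).2) := by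
    rw [hzli, hzlj]
    exact torus_sepVec_translate_smul (sub_nonneg.2 hat.le) hchart
  have hvel : ((zl i).2, (zl j).2) = ((γ a i).2, (γ a j).2) := by rw [hzli, hzlj]
  refine ⟨?_, ?_, ?_, ?_⟩
  · have h1 := (mem_contactSet.1 hc).2   -- contact: positions at `t` are those of the left limit
    rwa [heq, collidePair_apply_fst, collidePair_apply_fst, hsep] at h1
  · have h2 : ⟪(Torus.geometry d).sepVec (zl i).1 (zl j).1, (zl i).2 - (zl j).2⟫_ℝ < 0 := hin   -- incoming
    rwa [hsep, hzli, hzlj] at h2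
  · rw [heq, collidePair_apply_left hij, hsep, hvel, hzli]
  · rw [heq, collidePair_apply_right, hsep, hvel, hzlj]

/-- **No recollision (torus, in a chart).** If the spheres `i ≠ j` are in contact at time `t`, on `(t, t')`
every collision of `i` and every collision of `j` is a collision of the pair `{i, j}`, and
`ε + (t' − t)‖vᵢ(t) − vⱼ(t)‖ < 1/2` (the pair stays in one chart), then the pair is NOT in contact at any
time of `(t, t']`: after the elastic jump the pair is outgoing and the free relative motion separates it
(`‖n + τ u'‖² = ε² + 2τ⟪n, u'⟫ + τ²‖u'‖² > ε²`). -/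
theorem torus_not_mem_contactSet_after (h : IsHardSphereTrajectory (Torus.geometry d) ε N γ) {t t' : ℝ}
    {i j : Fin N} (hij : i ≠ j) (hc : γ t ∈ contactSet (Torus.geometry d) N ε i j)
    (hi : ∀ s ∈ Ioo t t', ∀ k, Collide (Torus.geometry d) ε (γ s) i k → k = j)
    (hj : ∀ s ∈ Ioo t t', ∀ k, Collide (Torus.geometry d) ε (γ s) j k → k = i)
    (hchart : ε + (t' - t) * ‖(γ t i).2 - (γ t j).2‖ < 1 / 2) :
    ∀ s ∈ Ioc t t', γ s ∉ contactSet (Torus.geometry d) N ε i j := by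
  have hGc : ∀ x, Continuous ((Torus.geometry d).translate x) := Torus.continuous_geometry_translate
  -- the pair is outgoing right after the jump
  have hout : 0 < ⟪(Torus.geometry d).sepVec (γ t i).1 (γ t j).1, (γ t i).2 - (γ t j).2⟫_ℝ := by
    obtain ⟨-, zl, -, hin, heq⟩ := h.binary t i j hij hc
    exact (heq ▸ (isOutgoing_collidePair_iff hij zl).2 hin : IsOutgoing (Torus.geometry d) (γ t) i j)
  have hnorm : ‖(Torus.geometry d).sepVec (γ t i).1 (γ t j).1‖ = ε := (mem_contactSet.1 hc).2
  -- suppose a contact of the pair in `(t, t']`; take the first participation of `i` after `t`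
  intro s hs hcs
  have hpart_s : Participates (Torus.geometry d) ε (γ s) i := ⟨j, Or.inl (mem_contactPairs.2 ⟨hij, hcs⟩)⟩
  have hne : (collisionTimesOf (Torus.geometry d) ε γ i ∩ Ioi t).Nonempty := ⟨s, hpart_s, hs.1⟩
  have hleast := h.isLeast_nthCollisionTimeOf_zero hne
  set s₁ := nthCollisionTimeOf (Torus.geometry d) ε γ t i 0 with hs₁
  have hs₁t : t < s₁ := hleast.1.2
  have hs₁s : s₁ ≤ s := hleast.2 ⟨hpart_s, hs.1⟩
  have hs₁t' : s₁ ≤ t' := hs₁s.trans hs.2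
  have hpart₁ : Participates (Torus.geometry d) ε (γ s₁) i := hleast.1.1
  -- no participation of `i`, hence of `j`, on `(t, s₁)`
  have hfree_i : ∀ τ ∈ Ioo t s₁, ¬ Participates (Torus.geometry d) ε (γ τ) i := fun τ hτ hp =>
    (not_lt.2 (hleast.2 ⟨hp, hτ.1⟩)) hτ.2
  have hfree_j : ∀ τ ∈ Ioo t s₁, ¬ Participates (Torus.geometry d) ε (γ τ) j := by
    rintro τ hτ ⟨k, hk⟩
    have hk' := hj τ ⟨hτ.1, hτ.2.trans_le hs₁t'⟩ k hk
    subst hk'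
    exact hfree_i τ hτ ⟨j, hk.symm⟩
  -- positions at `s₁` are the freely flown ones (inside the chart), so the pair is strictly separated there
  have hxi := fst_eq_translate_of_forall_not_participates_Ioo h hGc hs₁t hfree_i
  have hxj := fst_eq_translate_of_forall_not_participates_Ioo h hGc hs₁t hfree_j
  have hch : ‖(Torus.geometry d).sepVec (γ t i).1 (γ t j).1‖ + (s₁ - t) * ‖(γ t i).2 - (γ t j).2‖ < 1 / 2 := by
    have hle : (s₁ - t) * ‖(γ t i).2 - (γ t j).2‖ ≤ (t' - t) * ‖(γ t i).2 - (γ t j).2‖ :=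
      mul_le_mul_of_nonneg_right (by linarith) (norm_nonneg _)
    rw [hnorm]
    linarith
  have hsep : ε < ‖(Torus.geometry d).sepVec (γ s₁ i).1 (γ s₁ j).1‖ := by
    rw [hxi, hxj, torus_sepVec_translate_smul (sub_nonneg.2 hs₁t.le) hch]
    have hε : 0 ≤ ε := hnorm ▸ norm_nonneg _
    have hsq : ε ^ 2 < ‖(Torus.geometry d).sepVec (γ t i).1 (γ t j).1 +
        (s₁ - t) • ((γ t i).2 - (γ t j).2)‖ ^ 2 := by
      rw [norm_add_sq_real, hnorm, inner_smul_right, norm_smul]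
      have h1 : 0 < (s₁ - t) * ⟪(Torus.geometry d).sepVec (γ t i).1 (γ t j).1, (γ t i).2 - (γ t j).2⟫_ℝ :=
        mul_pos (by linarith) hout
      nlinarith [sq_nonneg (‖s₁ - t‖ * ‖(γ t i).2 - (γ t j).2‖)]
    exact lt_of_pow_lt_pow_left₀ 2 (norm_nonneg _) hsq
  -- but `i` participates at `s₁`, necessarily with `j`: contradiction
  have hcontact : γ s₁ ∈ contactSet (Torus.geometry d) N ε i j := by
    rcases hs₁t'.eq_or_lt with h₁ | h₁
    · -- `s₁ = t'`: then `s = t'` and the assumed contact is at `s₁`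
      have : s = s₁ := le_antisymm (h₁ ▸ hs.2) hs₁s
      rw [← this]; exact hcs
    · obtain ⟨k, hk⟩ := hpart₁
      have := hi s₁ ⟨hs₁t, h₁⟩ k hk
      subst this
      exact torus_mem_contactSet_of_collide hk
  exact (ne_of_gt hsep) (mem_contactSet.1 hcontact).2

/-- Under the hypotheses of `torus_not_mem_contactSet_after`, neither sphere participates in any collision
on `(t, t')`. -/
theorem torus_not_participates_after (h : IsHardSphereTrajectory (Torus.geometry d) ε N γ) {t t' : ℝ}
    {i j : Fin N} (hij : i ≠ j) (hc : γ t ∈ contactSet (Torus.geometry d) N ε i j)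
    (hi : ∀ s ∈ Ioo t t', ∀ k, Collide (Torus.geometry d) ε (γ s) i k → k = j)
    (hj : ∀ s ∈ Ioo t t', ∀ k, Collide (Torus.geometry d) ε (γ s) j k → k = i)
    (hchart : ε + (t' - t) * ‖(γ t i).2 - (γ t j).2‖ < 1 / 2) :
    ∀ s ∈ Ioo t t', ¬ Participates (Torus.geometry d) ε (γ s) i ∧
      ¬ Participates (Torus.geometry d) ε (γ s) j := by
  intro s hs
  have hno := torus_not_mem_contactSet_after h hij hc hi hj hchart s ⟨hs.1, hs.2.le⟩
  constructor
  · rintro ⟨k, hk⟩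
    have := hi s hs k hk; subst this
    exact hno (torus_mem_contactSet_of_collide hk)
  · rintro ⟨k, hk⟩
    have := hj s hs k hk; subst this
    exact hno (torus_mem_contactSet_comm.1 (torus_mem_contactSet_of_collide hk))

end Torus

/-! ## The registered stub: an isolated pair of `𝕋³` collides at most once, by the two-body kinematics -/

/-- **Registered stub `stub_torusIsolatedPair`** (line `ignition-cascade-refutation`, crux `InfluenceLocality`).
On a hard-sphere trajectory of `𝕋³`, if on `(a, b]` every collision of `i` is with `j` and conversely
(`i ≠ j`, `a < b`), and the pair stays in one chart (`‖q‖ + (b − a)‖u‖ < 1/2`, `q` the minimal-image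
separation and `u` the relative velocity at time `a`), then EITHER nobody of the pair collides on `(a, b]`
(and the free relative motion never reaches distance `ε` in the window), OR there is exactly one collision,
at a time `t ∈ (a, b]` given by the two-body kinematics: impact vector `n = q + (t − a)u` with `‖n‖ = ε`,
`⟪n, u⟫ < 0`, free flight of both spheres before `t`, post-collisional velocities
`reflectVel n (vᵢ(a), vⱼ(a))` at `t`, no collision of either sphere on `(t, b]`, free flight up to `b`. -/
theorem stub_torusIsolatedPair {n : ℕ} {ε : ℝ} {γ : ℝ → Config n (Fin 3) T3}
    (h : IsHardSphereTrajectory (Torus.geometry (Fin 3)) ε n γ) {a b : ℝ} (hab : a < b)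
    {i j : Fin n} (hij : i ≠ j)
    (hi : ∀ s ∈ Set.Ioc a b, ∀ k, Collide (Torus.geometry (Fin 3)) ε (γ s) i k → k = j)
    (hj : ∀ s ∈ Set.Ioc a b, ∀ k, Collide (Torus.geometry (Fin 3)) ε (γ s) j k → k = i)
    (hchart : ‖(Torus.geometry (Fin 3)).sepVec (γ a i).1 (γ a j).1‖
      + (b - a) * ‖(γ a i).2 - (γ a j).2‖ < 1 / 2) :
    ((∀ s ∈ Set.Ioc a b, ¬ Participates (Torus.geometry (Fin 3)) ε (γ s) i ∧
        ¬ Participates (Torus.geometry (Fin 3)) ε (γ s) j) ∧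
      ∀ t ∈ Set.Ioc a b, ‖(Torus.geometry (Fin 3)).sepVec (γ a i).1 (γ a j).1
        + (t - a) • ((γ a i).2 - (γ a j).2)‖ ≠ ε) ∨
    ∃ t ∈ Set.Ioc a b,
      ‖(Torus.geometry (Fin 3)).sepVec (γ a i).1 (γ a j).1 + (t - a) • ((γ a i).2 - (γ a j).2)‖ = ε ∧
      ⟪(Torus.geometry (Fin 3)).sepVec (γ a i).1 (γ a j).1 + (t - a) • ((γ a i).2 - (γ a j).2),
        (γ a i).2 - (γ a j).2⟫_ℝ < 0 ∧
      (∀ s ∈ Set.Ioo a t, ¬ Participates (Torus.geometry (Fin 3)) ε (γ s) i ∧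
        ¬ Participates (Torus.geometry (Fin 3)) ε (γ s) j) ∧
      γ t i = ((γ a i).1 + Torus.proj ((t - a) • (γ a i).2),
        (reflectVel ((Torus.geometry (Fin 3)).sepVec (γ a i).1 (γ a j).1 + (t - a) • ((γ a i).2 - (γ a j).2))
          ((γ a i).2, (γ a j).2)).1) ∧
      γ t j = ((γ a j).1 + Torus.proj ((t - a) • (γ a j).2),
        (reflectVel ((Torus.geometry (Fin 3)).sepVec (γ a i).1 (γ a j).1 + (t - a) • ((γ a i).2 - (γ a j).2))
          ((γ a i).2, (γ a j).2)).2) ∧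
      (∀ s ∈ Set.Ioc t b, ¬ Participates (Torus.geometry (Fin 3)) ε (γ s) i ∧
        ¬ Participates (Torus.geometry (Fin 3)) ε (γ s) j) ∧
      γ b i = ((γ t i).1 + Torus.proj ((b - t) • (γ t i).2), (γ t i).2) ∧
      γ b j = ((γ t j).1 + Torus.proj ((b - t) • (γ t j).2), (γ t j).2) := by
  have hGc : ∀ x, Continuous ((Torus.geometry (Fin 3)).translate x) := Torus.continuous_geometry_translate
  have hu0 : 0 ≤ ‖(γ a i).2 - (γ a j).2‖ := norm_nonneg _
  -- `j` participates only when `i` does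
  have hji : ∀ s ∈ Ioc a b, Participates (Torus.geometry (Fin 3)) ε (γ s) j →
      Participates (Torus.geometry (Fin 3)) ε (γ s) i := by
    rintro s hs ⟨k, hk⟩
    have := hj s hs k hk; subst this
    exact ⟨j, hk.symm⟩
  by_cases hne : (collisionTimesOf (Torus.geometry (Fin 3)) ε γ i ∩ Ioc a b).Nonempty
  · right
    obtain ⟨s₀, hs₀p, hs₀⟩ := hne
    have hne' : (collisionTimesOf (Torus.geometry (Fin 3)) ε γ i ∩ Ioi a).Nonempty := ⟨s₀, hs₀p, hs₀.1⟩
    have hleast := h.isLeast_nthCollisionTimeOf_zero hne'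
    set t := nthCollisionTimeOf (Torus.geometry (Fin 3)) ε γ a i 0 with ht
    have hat : a < t := hleast.1.2
    have htb : t ≤ b := (hleast.2 ⟨hs₀p, hs₀.1⟩).trans hs₀.2
    have hpart : Participates (Torus.geometry (Fin 3)) ε (γ t) i := hleast.1.1
    have hfree_i : ∀ τ ∈ Ioo a t, ¬ Participates (Torus.geometry (Fin 3)) ε (γ τ) i := fun τ hτ hp =>
      (not_lt.2 (hleast.2 ⟨hp, hτ.1⟩)) hτ.2
    have hfree_j : ∀ τ ∈ Ioo a t, ¬ Participates (Torus.geometry (Fin 3)) ε (γ τ) j := fun τ hτ hp =>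
      hfree_i τ hτ (hji τ ⟨hτ.1, hτ.2.le.trans htb⟩ hp)
    have hc : γ t ∈ contactSet (Torus.geometry (Fin 3)) n ε i j := by
      obtain ⟨k, hk⟩ := hpart
      have := hi t ⟨hat, htb⟩ k hk; subst this
      exact torus_mem_contactSet_of_collide hk
    have hchart_t : ‖(Torus.geometry (Fin 3)).sepVec (γ a i).1 (γ a j).1‖ +
        (t - a) * ‖(γ a i).2 - (γ a j).2‖ < 1 / 2 := by
      have hle : (t - a) * ‖(γ a i).2 - (γ a j).2‖ ≤ (b - a) * ‖(γ a i).2 - (γ a j).2‖ :=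
        mul_le_mul_of_nonneg_right (by linarith) hu0
      linarith
    obtain ⟨hnorm, hin, hti, htj⟩ := torus_fresh_collision h hat hij hc hfree_i hfree_j hchart_t
    refine ⟨t, ⟨hat, htb⟩, hnorm, hin, fun s hs => ⟨hfree_i s hs, hfree_j s hs⟩, hti, htj, ?_⟩
    rcases htb.eq_or_lt with rfl | htb'
    · exact ⟨fun s hs => absurd hs.2 (not_le.2 hs.1), by simp, by simp⟩
    have hi' : ∀ s ∈ Ioo t b, ∀ k, Collide (Torus.geometry (Fin 3)) ε (γ s) i k → k = j := fun s hs =>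
      hi s ⟨hat.trans hs.1, hs.2.le⟩
    have hj' : ∀ s ∈ Ioo t b, ∀ k, Collide (Torus.geometry (Fin 3)) ε (γ s) j k → k = i := fun s hs =>
      hj s ⟨hat.trans hs.1, hs.2.le⟩
    -- from time `t` the pair stays in the chart: the reflected relative velocity has the same norm
    have hchart' : ε + (b - t) * ‖(γ t i).2 - (γ t j).2‖ < 1 / 2 := by
      have hvel : ‖(γ t i).2 - (γ t j).2‖ = ‖(γ a i).2 - (γ a j).2‖ := by
        rw [hti, htj]
        exact norm_reflectVel_fst_sub_snd _ _
      have hε : ε ≤ ‖(Torus.geometry (Fin 3)).sepVec (γ a i).1 (γ a j).1‖ + (t - a) * ‖(γ a i).2 - (γ a j).2‖ := by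
        have := norm_add_le ((Torus.geometry (Fin 3)).sepVec (γ a i).1 (γ a j).1) ((t - a) • ((γ a i).2 - (γ a j).2))
        rwa [hnorm, norm_smul, Real.norm_of_nonneg (sub_nonneg.2 hat.le)] at this
      rw [hvel]
      have hsplit : (t - a) * ‖(γ a i).2 - (γ a j).2‖ + (b - t) * ‖(γ a i).2 - (γ a j).2‖ =
          (b - a) * ‖(γ a i).2 - (γ a j).2‖ := by ring
      linarith
    have hnp := torus_not_participates_after h hij hc hi' hj' hchart'
    -- no participation on `(t, b]`: at `b` itself a participation would be a contact of the pair
    have hno := torus_not_mem_contactSet_after h hij hc hi' hj' hchart'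
    have hnpi : ∀ s ∈ Ioc t b, ¬ Participates (Torus.geometry (Fin 3)) ε (γ s) i := by
      intro s hs
      rcases hs.2.eq_or_lt with rfl | hsb
      · rintro ⟨k, hk⟩
        have := hi s ⟨hat.trans hs.1, hs.2⟩ k hk
        subst this
        exact hno s ⟨hs.1, le_rfl⟩ (torus_mem_contactSet_of_collide hk)
      · exact (hnp s ⟨hs.1, hsb⟩).1
    have hnpj : ∀ s ∈ Ioc t b, ¬ Participates (Torus.geometry (Fin 3)) ε (γ s) j := by
      intro s hs
      rcases hs.2.eq_or_lt with rfl | hsb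
      · rintro ⟨k, hk⟩
        have := hj s ⟨hat.trans hs.1, hs.2⟩ k hk
        subst this
        exact hno s ⟨hs.1, le_rfl⟩ (torus_mem_contactSet_comm.1 (torus_mem_contactSet_of_collide hk))
      · exact (hnp s ⟨hs.1, hsb⟩).2
    exact ⟨fun s hs => ⟨hnpi s hs, hnpj s hs⟩,
      apply_eq_freeFlight_of_forall_not_participates h hGc htb'.le hnpi,
      apply_eq_freeFlight_of_forall_not_participates h hGc htb'.le hnpj⟩
  · left
    have hnpi : ∀ s ∈ Ioc a b, ¬ Participates (Torus.geometry (Fin 3)) ε (γ s) i := fun s hs hp =>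
      hne ⟨s, hp, hs⟩
    have hnpj : ∀ s ∈ Ioc a b, ¬ Participates (Torus.geometry (Fin 3)) ε (γ s) j := fun s hs hp =>
      hnpi s hs (hji s hs hp)
    refine ⟨fun s hs => ⟨hnpi s hs, hnpj s hs⟩, fun t ht hnorm => ?_⟩
    -- both fly freely up to `t` (inside the chart): a contact at `t` would be a participation of `i`
    have hxi := apply_eq_freeFlight_of_forall_not_participates h hGc ht.1.le
      (fun s hs => hnpi s ⟨hs.1, hs.2.trans ht.2⟩)
    have hxj := apply_eq_freeFlight_of_forall_not_participates h hGc ht.1.le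
      (fun s hs => hnpj s ⟨hs.1, hs.2.trans ht.2⟩)
    have hchart_t : ‖(Torus.geometry (Fin 3)).sepVec (γ a i).1 (γ a j).1‖ +
        (t - a) * ‖(γ a i).2 - (γ a j).2‖ < 1 / 2 := by
      have hle : (t - a) * ‖(γ a i).2 - (γ a j).2‖ ≤ (b - a) * ‖(γ a i).2 - (γ a j).2‖ :=
        mul_le_mul_of_nonneg_right (by linarith [ht.2]) hu0
      linarith
    have hct : γ t ∈ contactSet (Torus.geometry (Fin 3)) n ε i j := by
      refine mem_contactSet.2 ⟨h.mem t, ?_⟩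
      rw [hxi, hxj]
      dsimp only
      rw [torus_sepVec_translate_smul (sub_nonneg.2 ht.1.le) hchart_t]
      exact hnorm
    exact hnpi t ht ⟨j, Or.inl (mem_contactPairs.2 ⟨hij, hct⟩)⟩

end

end Summit.AtomisticToContinuum.HydrodynamicLimit.Theorems.InfluenceLocality.Negative
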